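import Literature.Computability.AlgebraicComplexity.LRFullLifts
import Literature.Computability.AlgebraicComplexity.LRLiftCharacter
import Literature.Computability.AlgebraicComplexity.LR21TorusWeights
import Literature.Computability.AlgebraicComplexity.VonZurGathenSingPermHeight
import HarnessLib

/-!
# Landsberg–Ressayre, Thm. 2.1 — the two-sided torus datum of an equivariant representation of `perm_m`

Topic `Literature/Computability/AlgebraicComplexity`.  Assembly-side piece of the bottom-up proof
of the named fact `lr_full_equivariant_lower` (`LandsbergRessayre.lean`; LR17 Thm. 2.1, lower
bound): from the tree's hypothesis `IsEquivariantDetRepr (permSymmetrySubst ℂ m) (perPoly (Fin m) ℂ) A`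
(`m ≥ 3`) it produces the two-sided torus datum `D : TorusData₂ m ℂⁿ` of `LR21TorusWeights.lean`
(seat-0 line) together with ALL the hypotheses an abstract count needs, so that the final assembly
is a one-liner once the two-sided count is available:

* `exists_torusData₂`: there is `D` with `D.Λ = Ã(0)`, `D.A k j = A_{kj}`, the primes
  `r = primes₂ m` (the `x`-th prime along `[m] ⊔ [m] ≃ [2m]`), and
  (i) `dim ker D.Λ = 1` — regularity, from von zur Gathen's theorem
      (`vonzurGathen1987_perm_detRepr_rank_holds`, LR17 Lemma 3.2);
  (ii) an injective member of the pencil (`Ã(1)`, of determinant `perm_m(1) = 1`);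
  (iii) exact lifts `Lift₂ D.Λ D.A σ π 1` of EVERY permutation pair (`LRFullLifts`);
  (iv) **the top weight is `wt (1, …, 1)`**: every weight space `D.E β` with `β ≠ D.wt 1` lies in
      `range D.Λ` (`LRLiftCharacter.maxGenEigenspace_le_range_of_ne_character`: the weight of the
      lifted torus on `ℓ_2 = ℂⁿ / range Λ` is the character `∏ p_k ∏ q_j` times its weight `γ₀` on
      `ℓ_1 = ker Λ`, LR17 Lemma 3.1/3.3, §6).
Hence the top exponent of the two-sided chain is `(1, …, 1; 1, …, 1)`, of row- and column-degree
`m`, which is what makes the descending chain of LR17 §6 pass through support sizes `(s, s)` for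
every `1 ≤ s ≤ m - 1` (the `C(m,s)²` weights of `Σ_s C(m,s)² = C(2m,m) - 2`, `LR21Count`).

Everything is proved; no named facts.

## References

* J. M. Landsberg, N. Ressayre, *Permanent v. determinant: an exponential lower bound assuming
  symmetry and a potential path towards Valiant's conjecture*, Differential Geom. Appl. 55 (2017)
  146–166, arXiv:1508.05788: Def. 1.3, Lemma 3.1, Lemma 3.2, Lemma 3.3, §6.
* J. von zur Gathen, *Permanent and determinant*, Linear Algebra Appl. 96 (1987) 87–100, Thm. 3.1.
-/

noncomputable section

namespace Literature.Computability.AlgebraicComplexity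

namespace LRPencil

open _root_.Matrix MvPolynomial Finset Module.End
open scoped Kronecker

/-! ### Distinct primes along `[m] ⊔ [m]` -/

section Primes

/-- The `x`-th prime along `[m] ⊔ [m] ≃ [2m]` (`2, 3, 5, …`): the diagonal of the generic torus
element `diag(p) ⊗ diag(q)` of LR17 §6 in elementary form. [folklore] -/
def primes₂ (m : ℕ) (x : Fin m ⊕ Fin m) : ℕ := Nat.nth Nat.Prime (finSumFinEquiv x)

/-- They are primes. [folklore] -/
theorem primes₂_prime (m : ℕ) (x : Fin m ⊕ Fin m) : (primes₂ m x).Prime := Nat.prime_nth_prime _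

/-- They are pairwise distinct. [folklore] -/
theorem primes₂_injective (m : ℕ) : Function.Injective (primes₂ m) := fun _ _ h =>
  finSumFinEquiv.injective (Fin.ext (Nat.nth_injective Nat.infinite_setOf_prime h))

/-- They are non-zero in `ℂ`. [folklore] -/
theorem primes₂_cast_ne_zero (m : ℕ) (x : Fin m ⊕ Fin m) : (primes₂ m x : ℂ) ≠ 0 :=
  Nat.cast_ne_zero.2 (primes₂_prime m x).ne_zero

end Primes

/-! ### The datum -/

section Datum

variable {m n : ℕ} {A : Matrix (Fin n) (Fin n) (MvPolynomial (Fin m × Fin m) ℂ)}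

/-- A representation of `perm_m` (`m ≥ 1`) has positive size. [folklore] -/
theorem pos_of_det_eq_perPoly (hm : 1 ≤ m) (hdet : A.det = perPoly (Fin m) ℂ) : 0 < n := by
  rcases Nat.eq_zero_or_pos n with h0 | h0
  · subst h0
    exfalso
    have h3 : A.det = 1 := Matrix.det_isEmpty
    have h4 := congrArg constantCoeff hdet
    rw [h3, constantCoeff_perPoly ℂ hm, map_one] at h4
    exact one_ne_zero h4
  · exact h0

/-- `Ã(1)` is an injective member of the pencil of a representation of `perm_m`
(`det Ã(1) = perm_m(1) = 1`). [folklore] -/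
theorem exists_injective_member (haff : ∀ r c, (A r c).totalDegree ≤ 1)
    (hdet : A.det = perPoly (Fin m) ℂ) :
    ∃ x : Fin m → Fin m → ℂ, Function.Injective
      (Matrix.toLin' (constPart A) + ∑ k, ∑ j, x k j • Matrix.toLin' (coeffMat A (k, j))) := by
  classical
  let v : Fin m × Fin m → ℂ := fun w => if w.1 = w.2 then 1 else 0
  refine ⟨fun k j => v (k, j), ?_⟩
  have hmat : Matrix.toLin' (constPart A) + ∑ k, ∑ j, v (k, j) • Matrix.toLin' (coeffMat A (k, j)) =
      Matrix.toLin' (A.map (MvPolynomial.eval v)) := by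
    rw [map_eval_eq A haff v, map_add, map_sum, Fintype.sum_prod_type]
    simp only [map_smul]
  have hdetv : (A.map (MvPolynomial.eval v)).det ≠ 0 := by
    have e : (A.map (MvPolynomial.eval v)).det = MvPolynomial.eval v A.det := by
      rw [RingHom.map_det]; rfl
    rw [e, hdet, eval_perPoly]
    have hv1 : (Matrix.of fun i j : Fin m => v (i, j)) = 1 := by
      ext i j; simp [v, Matrix.one_apply]
    rw [hv1, Matrix.permanent_one]; exact one_ne_zero
  rw [hmat]
  have hunit : IsUnit (A.map (MvPolynomial.eval v)) :=
    (Matrix.isUnit_iff_isUnit_det _).2 (isUnit_iff_ne_zero.2 hdetv)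
  intro x y hxy
  apply Matrix.mulVec_injective_iff_isUnit.2 hunit
  simpa [Matrix.toLin'_apply] using hxy

/-- **The two-sided torus datum of an equivariant representation of `perm_m`, with all count
hypotheses** (LR17 §6 for Thm. 2.1, elementary form): for `m ≥ 3` and `A` an affine determinantal
representation of `perm_m` over `ℂ` equivariant (exact lifts) for `permSymmetrySubst`, there is a
`TorusData₂` on `ℂⁿ` with `Λ = Ã(0)`, `A k j = A_{kj}` such that (i) `dim ker Λ = 1`
(von zur Gathen), (ii) some member of the pencil is injective, (iii) every permutation pair
`(σ, π)` has an exact `Lift₂`, and (iv) the top weight is `wt 1`: `β ≠ wt (1,…,1) ⇒ E β ⊆ range Λ`.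
[cite: LandsbergRessayre2017, §6] -/
theorem exists_torusData₂ (hm : 3 ≤ m)
    (hA : IsEquivariantDetRepr (permSymmetrySubst ℂ m) (perPoly (Fin m) ℂ) A) :
    ∃ D : TorusData₂ m (Fin n → ℂ),
      D.Λ = Matrix.toLin' (constPart A) ∧
      D.A = (fun k j => Matrix.toLin' (coeffMat A (k, j))) ∧
      D.r = primes₂ m ∧
      Module.finrank ℂ (LinearMap.ker D.Λ) = 1 ∧
      (∃ x : Fin m → Fin m → ℂ, Function.Injective (D.Λ + ∑ k, ∑ j, x k j • D.A k j)) ∧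
      (∀ σ π : Equiv.Perm (Fin m), Nonempty (Lift₂ D.Λ D.A σ π fun _ => (1 : ℂ))) ∧
      (∀ β, β ≠ D.wt (fun _ => 1) → D.E β ≤ LinearMap.range D.Λ) := by
  classical
  have haff : ∀ r c, (A r c).totalDegree ≤ 1 := hA.1.1
  have hdet : A.det = perPoly (Fin m) ℂ := hA.1.2
  have hn : 0 < n := pos_of_det_eq_perPoly (by omega) hdet
  have hreg : IsRegularDetRepr (perPoly (Fin m) ℂ) A :=
    hA.isRegular_perPoly vonzurGathen1987_perm_detRepr_rank_holds hm
  have hrank : (constPart A).rank = n - 1 := hreg.2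
  set Λm : Matrix (Fin n) (Fin n) ℂ := constPart A with hΛm
  set Am : Fin m → Fin m → Matrix (Fin n) (Fin n) ℂ := fun k j => coeffMat A (k, j) with hAm
  -- the torus pair `diag(p) ⊗ diag(q)` with `p ⊔ q = primes₂ m`, and its lift
  set r : Fin m ⊕ Fin m → ℕ := primes₂ m with hr
  set d : Fin m → ℂ := fun k => (r (Sum.inl k) : ℂ) with hd
  set e : Fin m → ℂ := fun j => (r (Sum.inr j) : ℂ) with he
  have hd0 : ∀ i, d i ≠ 0 := fun i => primes₂_cast_ne_zero m _
  have he0 : ∀ i, e i ≠ 0 := fun i => primes₂_cast_ne_zero m _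
  obtain ⟨P, Q, hPQ, hΛ, hkj⟩ := exists_torusPair_matrices hA d e hd0 he0
  have hc : ∀ x : Fin m ⊕ Fin m, ((fun x => (r x : ℂ)) x) ≠ 0 := fun x => primes₂_cast_ne_zero m x
  have hkj' : ∀ k j, (P : Matrix (Fin n) (Fin n) ℂ) * Am k j =
      ((fun x => (r x : ℂ)) (Sum.inl k) * (fun x => (r x : ℂ)) (Sum.inr j)) •
        (Am ((1 : Equiv.Perm (Fin m)) k) ((1 : Equiv.Perm (Fin m)) j) * (Q : Matrix (Fin n) (Fin n) ℂ)) :=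
    fun k j => hkj k j
  let L : Lift₂ (Matrix.toLin' Λm) (fun k j => Matrix.toLin' (Am k j)) 1 1 (fun x => (r x : ℂ)) :=
    lift₂OfMatrices Λm Am 1 1 _ hc P Q hΛ hkj'
  -- regularity: the kernel of `Λ` is a line, `C` acts on it by `γ₀`
  have hK : Module.finrank ℂ (LinearMap.ker (Matrix.toLin' Λm)) = 1 := finrank_ker_toLin'_eq_one hn hrank
  obtain ⟨γ₀, hγ₀, hker⟩ := exists_eigenvalue_of_finrank_ker_eq_one _ L.C L.map_ker_eq hK
  -- the datum
  let D : TorusData₂ m (Fin n → ℂ) :=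
    { Λ := Matrix.toLin' Λm, A := fun k j => Matrix.toLin' (Am k j), r := r,
      prime := primes₂_prime m, r_inj := primes₂_injective m, L := L, γ₀ := γ₀, ker_le := hker,
      γ₀_ne := hγ₀ }
  refine ⟨D, rfl, rfl, rfl, hK, exists_injective_member haff hdet,
    fun σ π => nonempty_lift₂_permPair hA σ π, ?_⟩
  -- (iv) the top weight is the character
  have htop := maxGenEigenspace_le_range_of_ne_character hn hdet hrank
    (coe_kronecker_diagUnit d e hd0 he0) hPQ hker
  have hwt : D.wt (fun _ => 1) = ((∏ k, d k) * ∏ j, e j) * γ₀ := by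
    show γ₀ * ∏ x, (r x : ℂ) ^ (fun _ : Fin m ⊕ Fin m => 1) x = ((∏ k, d k) * ∏ j, e j) * γ₀
    simp only [pow_one]
    rw [Fintype.prod_sum_type, mul_comm]
  intro β hβ
  rw [hwt] at hβ
  exact htop β hβ

end Datum

end LRPencil

end Literature.Computability.AlgebraicComplexity
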